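import Literature.NumberTheory.EllipticCurves.BinaryQuarticReducibleCountProofs
import HarnessLib

/-!
# Irreducibility of integral binary quartic forms is a `GL₂(ℤ)`-class invariant

Topic `Literature/NumberTheory/EllipticCurves`; companion of `BinaryQuarticForms.lean`
(`BinaryQuartic.IsIrreducible f ↔ a ≠ 0 ∧ f(x,1) irreducible in ℚ[X]`, the notion counted by
`gl2zClassCount` in Bhargava–Shankar's Theorem 2.1) and `BinaryQuarticReducibleCountProofs.lean`
(Gauss's lemma in the form `shape_of_not_isIrreducible`). Everything here is PROVED (no named
facts).

Bhargava–Shankar count `GL₂(ℤ)`-equivalence classes of *irreducible* integral forms (§2,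
Thm 2.1); that irreducibility is a class invariant is implicit there. We prove it for the tree's
definition:

* `linMulCubic`, `quadMulQuad` — the product forms `(px + qy)(rx³ + …)`,
  `(px² + qxy + ry²)(sx² + …)` and **their substitutions** `(L·C) ∘ γ = (L∘γ)·(C∘γ)`,
  `(Q₁Q₂) ∘ γ = (Q₁∘γ)(Q₂∘γ)` (`linMulCubic_subst`, `quadMulQuad_subst`); they are never
  irreducible (`not_isIrreducible_linMulCubic/quadMulQuad`);
* **`IsIrreducible.subst_of_isUnit`**: `f` irreducible, `γ ∈ GL₂(ℤ)` ⇒ `f ∘ γ` irreducible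
  (`(f∘γ).a = f(γ₀₀, γ₀₁) ≠ 0` since `f` has no rational zero; a factorisation of `f ∘ γ` would
  transport to `f` by `adj γ`); `isIrreducible_subst_iff`, `GL2ZEquiv.isIrreducible_iff`.

## References

* M. Bhargava, A. Shankar, Ann. of Math. (2) 181 (2015) 191–242, §2 (irreducible forms and their
  `GL₂(ℤ)`-classes; arXiv:1006.1002v2 numbering). [cite: BhargavaShankarAnnals2015, §2 (Thm 2.1: classes of irreducible forms; arXiv:1006.1002v2 numbering)]
-/

noncomputable section

open Polynomial

namespace Literature.NumberTheory.EllipticCurves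

namespace BinaryQuartic

/-! ## Product forms and their substitutions -/

/-- The quartic `(px + qy)(rx³ + sx²y + txy² + uy³)`. [folklore] -/
def linMulCubic (p q r s t u : ℤ) : BinaryQuartic ℤ :=
  ⟨p * r, p * s + q * r, p * t + q * s, p * u + q * t, q * u⟩

/-- The quartic `(px² + qxy + ry²)(sx² + txy + uy²)`. [folklore] -/
def quadMulQuad (p q r s t u : ℤ) : BinaryQuartic ℤ :=
  ⟨p * s, p * t + q * s, p * u + q * t + r * s, q * u + r * t, r * u⟩

/-- **`(L · C) ∘ γ = (L ∘ γ) · (C ∘ γ)`** for a linear form `L = px + qy` and a cubic form `C`, with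
`(x, y) ↦ (x, y)γ = (αx + βy, κx + λy)`. [folklore] -/
theorem linMulCubic_subst (p q r s t u : ℤ) (γ : Matrix (Fin 2) (Fin 2) ℤ) :
    (linMulCubic p q r s t u).subst γ =
      linMulCubic (p * γ 0 0 + q * γ 0 1) (p * γ 1 0 + q * γ 1 1)
        (r * γ 0 0 ^ 3 + s * γ 0 0 ^ 2 * γ 0 1 + t * γ 0 0 * γ 0 1 ^ 2 + u * γ 0 1 ^ 3)
        (3 * r * γ 0 0 ^ 2 * γ 1 0 + s * (γ 0 0 ^ 2 * γ 1 1 + 2 * γ 0 0 * γ 1 0 * γ 0 1) +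
          t * (2 * γ 0 0 * γ 0 1 * γ 1 1 + γ 1 0 * γ 0 1 ^ 2) + 3 * u * γ 0 1 ^ 2 * γ 1 1)
        (3 * r * γ 0 0 * γ 1 0 ^ 2 + s * (2 * γ 0 0 * γ 1 0 * γ 1 1 + γ 1 0 ^ 2 * γ 0 1) +
          t * (γ 0 0 * γ 1 1 ^ 2 + 2 * γ 1 0 * γ 0 1 * γ 1 1) + 3 * u * γ 0 1 * γ 1 1 ^ 2)
        (r * γ 1 0 ^ 3 + s * γ 1 0 ^ 2 * γ 1 1 + t * γ 1 0 * γ 1 1 ^ 2 + u * γ 1 1 ^ 3) := by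
  ext <;> simp only [linMulCubic, subst] <;> ring

/-- **`(Q₁ · Q₂) ∘ γ = (Q₁ ∘ γ) · (Q₂ ∘ γ)`** for quadratic forms. [folklore] -/
theorem quadMulQuad_subst (p q r s t u : ℤ) (γ : Matrix (Fin 2) (Fin 2) ℤ) :
    (quadMulQuad p q r s t u).subst γ =
      quadMulQuad (p * γ 0 0 ^ 2 + q * γ 0 0 * γ 0 1 + r * γ 0 1 ^ 2)
        (2 * p * γ 0 0 * γ 1 0 + q * (γ 0 0 * γ 1 1 + γ 1 0 * γ 0 1) + 2 * r * γ 0 1 * γ 1 1)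
        (p * γ 1 0 ^ 2 + q * γ 1 0 * γ 1 1 + r * γ 1 1 ^ 2)
        (s * γ 0 0 ^ 2 + t * γ 0 0 * γ 0 1 + u * γ 0 1 ^ 2)
        (2 * s * γ 0 0 * γ 1 0 + t * (γ 0 0 * γ 1 1 + γ 1 0 * γ 0 1) + 2 * u * γ 0 1 * γ 1 1)
        (s * γ 1 0 ^ 2 + t * γ 1 0 * γ 1 1 + u * γ 1 1 ^ 2) := by
  ext <;> simp only [quadMulQuad, subst] <;> ring

/-! ## Product forms are not irreducible -/

/-- A polynomial over `ℚ` of positive degree is not a unit. [folklore] -/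
theorem not_isUnit_of_natDegree_pos' {P : ℚ[X]} (h : 0 < P.natDegree) : ¬ IsUnit P :=
  fun hu => (Polynomial.natDegree_eq_zero_of_isUnit hu ▸ h).false.elim

/-- `(px + q)(rx³ + …)` is not irreducible. [folklore] -/
theorem not_isIrreducible_linMulCubic (p q r s t u : ℤ) : ¬ (linMulCubic p q r s t u).IsIrreducible := by
  rintro ⟨ha, hirr⟩
  have ha' : p * r ≠ 0 := ha
  have hp : p ≠ 0 := left_ne_zero_of_mul ha'
  have hr : r ≠ 0 := right_ne_zero_of_mul ha'
  have hfac : ((linMulCubic p q r s t u).map (Int.castRingHom ℚ)).toPoly =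
      (C (p : ℚ) * X + C (q : ℚ)) * (C (r : ℚ) * X ^ 3 + C (s : ℚ) * X ^ 2 + C (t : ℚ) * X + C (u : ℚ)) := by
    rw [toPoly_map, linMulCubic, toPoly_linMulCubic]
    simp [Polynomial.map_mul, Polynomial.map_add]
  rw [hfac] at hirr
  have h1 : ¬ IsUnit (C (p : ℚ) * X + C (q : ℚ)) := by
    apply not_isUnit_of_natDegree_pos'
    rw [Polynomial.natDegree_add_C, Polynomial.natDegree_C_mul_X _ (by exact_mod_cast hp)]
    exact one_pos
  have h2 : ¬ IsUnit (C (r : ℚ) * X ^ 3 + C (s : ℚ) * X ^ 2 + C (t : ℚ) * X + C (u : ℚ)) := by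
    apply not_isUnit_of_natDegree_pos'
    have : (C (r : ℚ) * X ^ 3 + C (s : ℚ) * X ^ 2 + C (t : ℚ) * X + C (u : ℚ)).natDegree = 3 := by
      have hr' : (r : ℚ) ≠ 0 := by exact_mod_cast hr
      compute_degree!
    rw [this]; norm_num
  rcases hirr.isUnit_or_isUnit rfl with hu | hu
  · exact h1 hu
  · exact h2 hu

/-- `(px² + qx + r)(sx² + tx + u)` is not irreducible. [folklore] -/
theorem not_isIrreducible_quadMulQuad (p q r s t u : ℤ) : ¬ (quadMulQuad p q r s t u).IsIrreducible := by
  rintro ⟨ha, hirr⟩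
  have ha' : p * s ≠ 0 := ha
  have hp : p ≠ 0 := left_ne_zero_of_mul ha'
  have hs : s ≠ 0 := right_ne_zero_of_mul ha'
  have hfac : ((quadMulQuad p q r s t u).map (Int.castRingHom ℚ)).toPoly =
      (C (p : ℚ) * X ^ 2 + C (q : ℚ) * X + C (r : ℚ)) * (C (s : ℚ) * X ^ 2 + C (t : ℚ) * X + C (u : ℚ)) := by
    rw [toPoly_map, quadMulQuad, toPoly_quadMulQuad]
    simp [Polynomial.map_mul, Polynomial.map_add]
  rw [hfac] at hirr
  have h1 : ¬ IsUnit (C (p : ℚ) * X ^ 2 + C (q : ℚ) * X + C (r : ℚ)) := by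
    apply not_isUnit_of_natDegree_pos'
    have : (C (p : ℚ) * X ^ 2 + C (q : ℚ) * X + C (r : ℚ)).natDegree = 2 := by
      have hp' : (p : ℚ) ≠ 0 := by exact_mod_cast hp
      compute_degree!
    rw [this]; norm_num
  have h2 : ¬ IsUnit (C (s : ℚ) * X ^ 2 + C (t : ℚ) * X + C (u : ℚ)) := by
    apply not_isUnit_of_natDegree_pos'
    have : (C (s : ℚ) * X ^ 2 + C (t : ℚ) * X + C (u : ℚ)).natDegree = 2 := by
      have hs' : (s : ℚ) ≠ 0 := by exact_mod_cast hs
      compute_degree!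
    rw [this]; norm_num
  rcases hirr.isUnit_or_isUnit rfl with hu | hu
  · exact h1 hu
  · exact h2 hu

/-! ## `GL₂(ℤ)`-invariance of irreducibility -/

/-- `f ∘ (c • 1) = c⁴ f`. [folklore] -/
theorem subst_smul_one_int (f : BinaryQuartic ℤ) (c : ℤ) :
    f.subst (c • (1 : Matrix (Fin 2) (Fin 2) ℤ)) = (c ^ 4) • f := by
  ext <;> simp [subst, Matrix.smul_apply] <;> ring

/-- For `γ ∈ GL₂(ℤ)`, `(f ∘ γ) ∘ adj(γ) = f`. [folklore] -/
theorem subst_subst_adjugate {f : BinaryQuartic ℤ} {γ : Matrix (Fin 2) (Fin 2) ℤ} (hγ : IsUnit γ.det) :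
    (f.subst γ).subst γ.adjugate = f := by
  rw [← subst_mul, Matrix.adjugate_mul, subst_smul_one_int]
  have h4 : γ.det ^ 4 = 1 := by
    rcases Int.isUnit_iff.1 hγ with h | h <;> rw [h] <;> norm_num
  rw [h4, one_smul]

/-- **Irreducibility is `GL₂(ℤ)`-invariant**: if `f` is irreducible and `γ ∈ GL₂(ℤ)` then `f ∘ γ`
is irreducible. If `(f ∘ γ).a = f(γ₀₀, γ₀₁) = 0`, `f` would have a rational zero; otherwise a
factorisation of `f ∘ γ` (Gauss's lemma, `shape_of_not_isIrreducible`) is transported back to `f`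
by `adj(γ)`. [folklore] -/
theorem IsIrreducible.subst_of_isUnit {f : BinaryQuartic ℤ} (hf : f.IsIrreducible) {γ : Matrix (Fin 2) (Fin 2) ℤ}
    (hγ : IsUnit γ.det) : (f.subst γ).IsIrreducible := by
  by_contra hnot
  by_cases ha : (f.subst γ).a = 0
  · -- `f` has the rational zero `(γ₀₀, γ₀₁)`
    rw [subst_a] at ha
    have hne : (γ 0 0 : ℚ) ≠ 0 ∨ (γ 0 1 : ℚ) ≠ 0 := by
      by_contra hcon
      push Not at hcon
      have h0 : γ 0 0 = 0 := by exact_mod_cast hcon.1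
      have h1 : γ 0 1 = 0 := by exact_mod_cast hcon.2
      have : γ.det = 0 := by rw [Matrix.det_fin_two, h0, h1]; ring
      exact hγ.ne_zero this
    apply hf.eval_ne_zero hne
    have := eval_map (Int.castRingHom ℚ) f (γ 0 0) (γ 0 1)
    simp only [eq_intCast] at this
    rw [this, ha]; simp
  · rcases shape_of_not_isIrreducible ha hnot with ⟨p, q, r, s, t, u, hshape⟩ | ⟨p, q, r, s, t, u, hshape⟩
    · have hf' : f = (linMulCubic p q r s t u).subst γ.adjugate := by
        rw [← subst_subst_adjugate (f := f) hγ, hshape]; rfl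
      rw [linMulCubic_subst] at hf'
      exact not_isIrreducible_linMulCubic _ _ _ _ _ _ (hf' ▸ hf)
    · have hf' : f = (quadMulQuad p q r s t u).subst γ.adjugate := by
        rw [← subst_subst_adjugate (f := f) hγ, hshape]; rfl
      rw [quadMulQuad_subst] at hf'
      exact not_isIrreducible_quadMulQuad _ _ _ _ _ _ (hf' ▸ hf)

/-- **Irreducibility is a `GL₂(ℤ)`-class invariant.** [folklore] -/
theorem isIrreducible_subst_iff {f : BinaryQuartic ℤ} {γ : Matrix (Fin 2) (Fin 2) ℤ} (hγ : IsUnit γ.det) :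
    (f.subst γ).IsIrreducible ↔ f.IsIrreducible := by
  refine ⟨fun h => ?_, fun h => h.subst_of_isUnit hγ⟩
  have h2 := h.subst_of_isUnit (γ := γ.adjugate) (by rw [Matrix.det_adjugate]; exact hγ.pow _)
  rwa [subst_subst_adjugate hγ] at h2

/-- Irreducibility is constant on `GL₂(ℤ)`-equivalence classes. [folklore] -/
theorem GL2ZEquiv.isIrreducible_iff {f g : BinaryQuartic ℤ} (h : GL2ZEquiv f g) :
    g.IsIrreducible ↔ f.IsIrreducible := by
  obtain ⟨γ, hγ, rfl⟩ := h
  exact isIrreducible_subst_iff hγ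

end BinaryQuartic

end Literature.NumberTheory.EllipticCurves

end
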